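/-
Copyright: the b2b-balaban T⁴-continuum CRUX team, row NE7b leaf lineage `t4-ne7b-formalise-leaf-04` (gen 155). Project licence.
-/
import Literature.Analysis.Convex.ProximalMap
import Mathlib.Analysis.Convex.Strong
import Mathlib.Analysis.Calculus.Gradient.Basic

/-!
# MOREAU's THEOREM ON A WINDOW: for `f` (`m`-strongly) convex ON a convex window `K` only (value `+∞` off `K`) the windowed
# envelope `e_K(x) = min_{z ∈ K} [f z + ½‖z − x‖²]` is `C¹` on ALL of `E` with gradient `x − p x` (`p x ∈ K` the windowed proximal
# point: unique, characterised by the variational inequality `x − p x ∈ ∂(f + ι_K)(p x)`), the gradient is `1`-Lipschitz, `p` is a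
# `(1+m)⁻¹`-contraction, and `e_K` is `(m∕(1+m))`-strongly convex ON `univ` with growth constant `½` — although `f + ι_K` jumps to
# `+∞` across `∂K` (row NE7b, node U5c; residual (R2′) family (2), letters (ℓ1)∕(ℓ2) through a classical SOFT step ON PRINT's
# WINDOWS; [folklore] convex analysis)

Cell `pub-balaban`, sub-cell `t4`, spine estimate NE7b (`T4WeightBudget.RelWeightBound`; the cell's OWN estimate — NOT PRINTED in
[Bałaban 1983–89], NOT PROVED).  Crux-route work under `Spine/NE7b/` by leaf-04 on the convexity road; NOTHING of Bałaban's is named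
or asserted; no `T4Continuum/Support` leaf typed; no `def`; zero `sorry`.  Imports: the tree's BUILT `Literature.Analysis.Convex.ProximalMap`
(`proxFun f x z = f z + ‖z − x‖²∕2`, `norm_sub_sq_eq_of_mid`, `prox`, `isMinOn_prox`) and Mathlib — independent of the `Spine/NE7b` olean
frontier; it does NOT import this lineage's `…MoreauEnvelopeLetters` (MEL) ∕ `…MoreauProxJacobian` (MPJ) ∕ `…SoftConstraintEnvelope`
(SCE), whose `K = univ` statements it generalises and whose common NOT-HERE it types.

WHY.  MEL types Moreau's theorem for a FINITE convex `f` on `univ` (the tree's `prox`, finite dimension); SCE reduces the road's soft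
(quadratic-penalty) averaging step to a Moreau envelope of the hard value.  Both list the same NOT-HERE: MEL «convex `f` with value `+∞`
off a window … the envelope of a windowed `f` is still `C¹` — not typed», SCE «windows (`S = +∞` off `K` needs `φ_K` and a constrained
prox)».  On the road the fine action is convex ON A CONVEX WINDOW `K` only (print's small-field windows; the OWNER's `…ConvexWindow*`
files: «`V` λ-convex ON `K` only»): the step sees the closed convex function `f + ι_K`, neither differentiable nor finite across `∂K`.
THIS FILE types Moreau's theorem for `f + ι_K` WITHOUT a new definition — the windowed proximal point enters as a SELECTION `p : E → E`
with the letters `p y ∈ K`, `IsMinOn (proxFun f y) K (p y)` (§1: it EXISTS and is UNIQUE) — on a GENERAL real inner product space, for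
`StrongConvexOn K m f` with ANY `0 ≤ m` (`m = 0` = convex): a soft classical step taken ON A WINDOW still manufactures a globally
defined, globally `C¹`, globally (strongly) convex next action with the kernel's growth constant — the window's wall is absorbed.

WHAT IS PROVED ([folklore]: Moreau, Bull. SMF 93 (1965) 273–299 (any closed proper convex function — here `f + ι_K`); Hiriart-Urruty–
Lemaréchal 2001 Chap. E Ex. 2.1.4, Chap. D Prop. 6.1.1; Bauschke–Combettes 2011 Prop. 12.26–12.30; Rockafellar–Wets Thm. 2.26 — proved
here from order arithmetic and polarisation, nothing cited as a fact).  `f : E → ℝ`, `K ⊆ E`; «`y` is a windowed proximal point of `x`»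
is WRITTEN OUT as `y ∈ K`, `IsMinOn (proxFun f x) K y`; the envelope as `proxFun f x (p x)`.
* §1 WINDOWED PROXIMAL POINTS: `proxFun_add_le_of_hasSubgradientWithinAt` (the variational inequality gives QUADRATIC GROWTH
  `proxFun f x y + ½‖z − y‖² ≤ proxFun f x z` on `K`, hence `isMinOn_proxFun_of_hasSubgradientWithinAt`); conversely
  **`hasSubgradientWithinAt_of_isMinOn_proxFun`** (`ConvexOn ℝ K f`, `y ∈ K`, `IsMinOn` ⟹ `∀ z ∈ K, f y + ⟪x − y, z − y⟫ ≤ f z`, first-order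
  optimality along segments INSIDE `K`; the tree's `isMinOn_proxFun_iff` is `K = univ`), **`isMinOn_proxFun_iff_hasSubgradientWithinAt`**,
  **`eq_of_isMinOn_proxFun`** (uniqueness), EXISTENCE **`exists_isMinOn_proxFun_of_isCompact`** (`K` compact nonempty, `f` continuous on
  `K`; any `E`) and **`exists_isMinOn_proxFun_of_isClosed`** (finite dimension; `K` closed nonempty, `f` continuous and BOUNDED BELOW on `K`).
* §2 THE TWO LETTERS ABOUT EVERY POINT: **`strongSubgradient_windowProx`** (`StrongConvexOn K m f`, `0 ≤ m`, `z ∈ K`: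
  `f (p x) + ⟪x − p x, z − p x⟫ + (m∕2)‖z − p x‖² ≤ f z`, via the RESCALED window problem `(f − (m∕2)‖·‖²)∕(1+m)` at `x∕(1+m)`),
  `windowEnv_upper` (GROWTH, the kernel's `½`: `e_K(x′) ≤ e_K(x) + ⟪x − p x, x′ − x⟫ + ½‖x′ − x‖²` — the competitor `p x ∈ K` at `x′`),
  **`windowEnv_lower`** (MODULUS `m∕(1+m)`: `e_K(x) + ⟪x − p x, x′ − x⟫ + ((m∕(1+m))∕2)‖x′ − x‖² ≤ e_K(x′)` — resistances add).
* §3 **MOREAU's THEOREM ON A WINDOW** `hasFDerivAt_windowEnv` (`HasFDerivAt (y ↦ proxFun f y (p y)) ⟪x − p x, ·⟫ x` at EVERY `x : E`),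
  `hasGradientAt_windowEnv` (`E` complete), **`strongConvexOn_windowEnv`** (`StrongConvexOn univ (m∕(1+m)) e_K` — on ALL of `E`),
  `convexOn_windowEnv`.
* §4 CONTRACTION: **`norm_windowProx_sub_le`** (`(1+m)‖p x − p x′‖² ≤ ⟪x − x′, p x − p x′⟫` and `‖p x − p x′‖ ≤ (1+m)⁻¹‖x − x′‖`),
  `lipschitzWith_windowProx`, **`norm_windowGrad_sub_le`** (`‖(x − p x) − (x′ − p x′)‖ ≤ ‖x − x′‖`: `e_K ∈ C^{1,1}` with constant `1`).
* §5 JUNCTIONS: `K = univ` — MEL's Moreau theorem is the instance `p := prox f` (`example`); `f = 0` — the windowed proximal point is the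
  METRIC PROJECTION (**`isMinOn_proxFun_zero_iff`**: the obtuse-angle criterion `∀ z ∈ K, ⟪x − y, z − y⟫ ≤ 0`) and `½·dist(·, K)²` is `C¹`
  with derivative `⟪x − proj_K x, ·⟫` for ANY selection of nearest points in a convex `K` (**`hasFDerivAt_half_dist_sq`**).

NOT HERE (honest): SCE's weight-`a` ∕ operator-`P` bookkeeping on a window (`φ_K u = min {S y : y ∈ K, P y = u}` is convex on the convex
window `P '' K` by SCE §3's engine — then this file applies with `K ↦ P '' K`; typed when a consumer names the shape); `C¹` dependence of
`p` (MPJ's implicit-function road fails where `p x ∈ ∂K`: the windowed `p` is Lipschitz, not `C¹`, in general); lower semicontinuous `f`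
beyond `ContinuousOn f K`; existence on closed windows in infinite dimension; which `S, K, a` are Bałaban's ((A3) ∕ (A1c), NC-NE7b-α
UNRULED); anything of Bałaban's.  BY-NAME EFFECT ON THE WALL: NONE.  NE7b NOT PRINTED ∕ NOT PROVED; spine PROVED 0∕9; rung (B)+1 on a
FINITE torus — NOT infinite volume, NOT the mass gap, NOT Clay.  HONEST DEPENDENCY: continuum YM on T⁴ ⇐ BetaPertH ∧ nine spine estimates
(0/9 proved); BetaPertH ⇐ (D1) ∧ (D4) ∧ CAP+tail; G-an2-4 gates asym, D1 and NE2∕3∕4.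
-/

set_option autoImplicit false

noncomputable section

namespace Summit.QuantumFields.BalabanUV.T4Continuum.NE7b.WindowedMoreauEnvelope

open Set Filter Topology Metric InnerProductSpace
open scoped RealInnerProductSpace Gradient
open Literature.Analysis.Convex

variable {E : Type*} [NormedAddCommGroup E] [InnerProductSpace ℝ E]
variable {f : E → ℝ} {K : Set E} {x x' y z : E} {p : E → E} {m : ℝ}

/-! ## §1 Windowed proximal points: characterisation, quadratic growth, uniqueness, existence -/

/-- **SUFFICIENCY OF THE VARIATIONAL INEQUALITY, WITH QUADRATIC GROWTH**: if `x − y ∈ ∂_K f(y)` (`∀ z ∈ K, f y + ⟪x − y, z − y⟫ ≤ f z`)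
then `proxFun f x y + ½‖z − y‖² ≤ proxFun f x z` for every `z ∈ K` (polarisation; no convexity, no membership of `y`). [folklore] -/
theorem proxFun_add_le_of_hasSubgradientWithinAt (h : HasSubgradientWithinAt f K (x - y) y) (hz : z ∈ K) :
    proxFun f x y + ‖z - y‖ ^ 2 / 2 ≤ proxFun f x z := by
  have h1 : f y + ⟪x - y, z - y⟫ ≤ f z := h z hz
  have h2 := norm_sub_sq_eq_of_mid x y z
  have h3 : ⟪z - y, y - x⟫ = -⟪x - y, z - y⟫ := by rw [real_inner_comm, ← neg_sub x y, inner_neg_left]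
  simp only [proxFun_apply]
  nlinarith [h1, h2, h3]

/-- If `x − y ∈ ∂_K f(y)` then `y` minimises the proximal functional ON THE WINDOW. [folklore] -/
theorem isMinOn_proxFun_of_hasSubgradientWithinAt (h : HasSubgradientWithinAt f K (x - y) y) :
    IsMinOn (proxFun f x) K y := fun z hz => by
  have := proxFun_add_le_of_hasSubgradientWithinAt h hz
  have h0 : 0 ≤ ‖z - y‖ ^ 2 / 2 := by positivity
  show proxFun f x y ≤ proxFun f x z
  linarith

/-- **NECESSITY OF THE VARIATIONAL INEQUALITY** (first-order optimality ON A CONVEX WINDOW): `f` convex on `K`, `y ∈ K` minimising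
`proxFun f x` on `K` ⟹ `f y + ⟪x − y, z − y⟫ ≤ f z` for every `z ∈ K`.  The segment `y + t(z − y)`, `t ∈ (0, 1]`, stays IN `K`; compare
values, use convexity of `f` along it, divide by `t`, let `t → 0` (the tree's `IsMinOn.hasSubgradientWithinAt_of_proxFun` is `K = univ`).
[folklore] -/
theorem hasSubgradientWithinAt_of_isMinOn_proxFun (hf : ConvexOn ℝ K f) (hy : y ∈ K)
    (hmin : IsMinOn (proxFun f x) K y) : HasSubgradientWithinAt f K (x - y) y := by
  intro z hz
  have hQ0 : 0 ≤ ‖z - y‖ ^ 2 / 2 := by positivity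
  have key : ∀ t : ℝ, 0 < t → t ≤ 1 → 0 ≤ f z - f y + ⟪y - x, z - y⟫ + t * (‖z - y‖ ^ 2 / 2) := by
    intro t ht0 ht1
    have hpt : (1 - t) • y + t • z = y + t • (z - y) := by simp only [sub_smul, one_smul, smul_sub]; abel
    have hseg : y + t • (z - y) ∈ K := by rw [← hpt]; exact hf.1 hy hz (by linarith) ht0.le (by ring)
    have hmin' : proxFun f x y ≤ proxFun f x (y + t • (z - y)) := hmin hseg
    have hconv := hf.2 hy hz (by linarith : 0 ≤ 1 - t) ht0.le (by ring)
    rw [hpt, smul_eq_mul, smul_eq_mul] at hconv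
    have hq : ‖y + t • (z - y) - x‖ ^ 2 = ‖y - x‖ ^ 2 + 2 * t * ⟪y - x, z - y⟫ + t ^ 2 * ‖z - y‖ ^ 2 := by
      have e : y + t • (z - y) - x = (y - x) + t • (z - y) := by abel
      rw [e, ← real_inner_self_eq_norm_sq, ← real_inner_self_eq_norm_sq, ← real_inner_self_eq_norm_sq]
      simp only [inner_add_left, inner_add_right, real_inner_smul_left, real_inner_smul_right,
        real_inner_comm (z - y) (y - x)]
      ring
    simp only [proxFun_apply] at hmin'
    rw [hq] at hmin'
    have h4 : t * (f z - f y + ⟪y - x, z - y⟫ + t * (‖z - y‖ ^ 2 / 2)) ≥ 0 := by nlinarith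
    exact nonneg_of_mul_nonneg_right h4 ht0
  have hA : 0 ≤ f z - f y + ⟪y - x, z - y⟫ := by
    refine le_of_forall_pos_le_add fun ε hε => ?_
    set Q := ‖z - y‖ ^ 2 / 2 with hQ
    have ht0 : 0 < min 1 (ε / (Q + 1)) := lt_min one_pos (by positivity)
    have h2 : min 1 (ε / (Q + 1)) * Q ≤ ε / (Q + 1) * Q := mul_le_mul_of_nonneg_right (min_le_right _ _) hQ0
    have h3 : ε / (Q + 1) * Q ≤ ε := by rw [div_mul_eq_mul_div, div_le_iff₀ (by positivity)]; nlinarith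
    have := key _ ht0 (min_le_left _ _)
    linarith
  have e : ⟪x - y, z - y⟫ = -⟪y - x, z - y⟫ := by rw [← neg_sub y x, inner_neg_left]
  linarith

/-- **CHARACTERISATION OF THE WINDOWED PROXIMAL POINT** (`f` convex on `K`, `y ∈ K`): `y` minimises `z ↦ f z + ½‖z − x‖²` ON `K` iff
`x − y ∈ ∂_K f(y)` — the resolvent inclusion `x − y ∈ ∂(f + ι_K)(y)`. [folklore] -/
theorem isMinOn_proxFun_iff_hasSubgradientWithinAt (hf : ConvexOn ℝ K f) (hy : y ∈ K) :
    IsMinOn (proxFun f x) K y ↔ HasSubgradientWithinAt f K (x - y) y :=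
  ⟨hasSubgradientWithinAt_of_isMinOn_proxFun hf hy, isMinOn_proxFun_of_hasSubgradientWithinAt⟩

/-- **UNIQUENESS ON THE WINDOW**: two minimisers of the proximal functional on a convex window coincide (quadratic growth). [folklore] -/
theorem eq_of_isMinOn_proxFun (hf : ConvexOn ℝ K f) {y₁ y₂ : E} (hy₁ : y₁ ∈ K) (hy₂ : y₂ ∈ K)
    (h₁ : IsMinOn (proxFun f x) K y₁) (h₂ : IsMinOn (proxFun f x) K y₂) : y₁ = y₂ := by
  have k₁ := proxFun_add_le_of_hasSubgradientWithinAt (hasSubgradientWithinAt_of_isMinOn_proxFun hf hy₁ h₁) hy₂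
  have k₂ : proxFun f x y₂ ≤ proxFun f x y₁ := h₂ hy₁
  have h0 : ‖y₂ - y₁‖ ^ 2 = 0 := le_antisymm (by linarith) (by positivity)
  rw [sq_eq_zero_iff, norm_eq_zero, sub_eq_zero] at h0; exact h0.symm

omit [InnerProductSpace ℝ E] in
/-- The proximal functional is continuous on `K` when `f` is. [folklore] -/
theorem continuousOn_proxFun (hfc : ContinuousOn f K) (x : E) : ContinuousOn (proxFun f x) K :=
  hfc.add (((continuous_id.sub continuous_const).norm.pow 2).div_const 2).continuousOn

omit [InnerProductSpace ℝ E] in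
/-- **EXISTENCE ON A COMPACT WINDOW** (any normed `E`): `K` compact nonempty, `f` continuous on `K`. [folklore] -/
theorem exists_isMinOn_proxFun_of_isCompact (hK : IsCompact K) (hne : K.Nonempty) (hfc : ContinuousOn f K) (x : E) :
    ∃ y ∈ K, IsMinOn (proxFun f x) K y :=
  hK.exists_isMinOn hne (continuousOn_proxFun hfc x)

/-- **EXISTENCE ON A CLOSED WINDOW** (finite dimension): `K` closed nonempty, `f` continuous and BOUNDED BELOW on `K` (`c ≤ f` on `K`).
With `x₀ ∈ K`, `d = ‖x₀ − x‖`, `M = f x₀ − c ≥ 0`, `R = d + M + 1`: every `z ∈ K` off `closedBall x R` has `proxFun f x z ≥ c + ½R² ≥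
proxFun f x x₀`, and the continuous functional attains its minimum on the compact `K ∩ closedBall x R ∋ x₀`. [folklore] -/
theorem exists_isMinOn_proxFun_of_isClosed [FiniteDimensional ℝ E] (hK : IsClosed K) (hne : K.Nonempty)
    (hfc : ContinuousOn f K) (hbdd : ∃ c : ℝ, ∀ z ∈ K, c ≤ f z) (x : E) :
    ∃ y ∈ K, IsMinOn (proxFun f x) K y := by
  haveI : ProperSpace E := FiniteDimensional.proper ℝ E
  obtain ⟨x₀, hx₀⟩ := hne
  obtain ⟨c, hc⟩ := hbdd
  set d : ℝ := ‖x₀ - x‖ with hd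
  set M : ℝ := f x₀ - c with hM
  have hM0 : 0 ≤ M := by have := hc x₀ hx₀; rw [hM]; linarith
  set R : ℝ := d + M + 1 with hR
  have hR0 : 0 ≤ R := by rw [hR]; linarith [norm_nonneg (x₀ - x)]
  have hKc : IsCompact (K ∩ closedBall x R) := (isCompact_closedBall x R).inter_left hK
  have hx₀' : x₀ ∈ K ∩ closedBall x R := ⟨hx₀, by rw [mem_closedBall, dist_eq_norm, hR]; linarith⟩
  obtain ⟨y, ⟨hyK, -⟩, hymin⟩ :=
    hKc.exists_isMinOn ⟨x₀, hx₀'⟩ ((continuousOn_proxFun hfc x).mono inter_subset_left)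
  refine ⟨y, hyK, fun z hz => ?_⟩
  show proxFun f x y ≤ proxFun f x z
  by_cases hzB : z ∈ closedBall x R
  · exact hymin ⟨hz, hzB⟩
  · have hzR : R < ‖z - x‖ := by rwa [mem_closedBall, dist_eq_norm, not_le] at hzB
    have hsq : R ^ 2 ≤ ‖z - x‖ ^ 2 := pow_le_pow_left₀ hR0 hzR.le 2
    have h1 : proxFun f x x₀ ≤ proxFun f x z := by
      simp only [proxFun_apply]
      have hcz := hc z hz
      rw [← hd]
      nlinarith [hsq, hcz, hM0, norm_nonneg (x₀ - x), hR, hM]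
    exact (hymin hx₀').trans h1

/-! ## §2 The two letters about every point, from `f`'s data ON `K` alone -/

/-- **THE STRONG VARIATIONAL INEQUALITY AT THE WINDOWED PROXIMAL POINT**: `StrongConvexOn K m f` (`0 ≤ m`; `m = 0` is §1), `p x ∈ K`
minimising `proxFun f x` on `K`, `z ∈ K` ⟹ `f (p x) + ⟪x − p x, z − p x⟫ + (m∕2)‖z − p x‖² ≤ f z`.  `p x` also minimises ON `K` the
proximal functional of the convex-on-`K` `g = (f − (m∕2)‖·‖²)∕(1+m)` based at `x∕(1+m)` (the functionals differ by the factor `1+m` and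
a constant); apply §1 to `g` and complete the square. [folklore] -/
theorem strongSubgradient_windowProx (hf : StrongConvexOn K m f) (hm : 0 ≤ m) (hpK : p x ∈ K)
    (hp : IsMinOn (proxFun f x) K (p x)) (hz : z ∈ K) :
    f (p x) + ⟪x - p x, z - p x⟫ + m / 2 * ‖z - p x‖ ^ 2 ≤ f z := by
  have h1m : 0 < 1 + m := by linarith
  set q := p x with hq
  set g : E → ℝ := fun z => (f z - m / 2 * ‖z‖ ^ 2) / (1 + m) with hg
  have hgc : ConvexOn ℝ K g := by
    have hc : ConvexOn ℝ K (fun z => f z - m / 2 * ‖z‖ ^ 2) := strongConvexOn_iff_convex.mp hf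
    simpa [hg, div_eq_inv_mul] using hc.smul (inv_nonneg.mpr h1m.le)
  set x₁ : E := (1 + m)⁻¹ • x with hx₁
  have key : ∀ w : E, (1 + m) * proxFun g x₁ w = proxFun f x w - m / (2 * (1 + m)) * ‖x‖ ^ 2 := by
    intro w
    simp only [proxFun_apply, hg, hx₁]
    rw [norm_sub_sq_real w ((1 + m)⁻¹ • x), norm_sub_sq_real w x, real_inner_smul_right, norm_smul, Real.norm_eq_abs,
      abs_of_pos (inv_pos.mpr h1m), mul_pow]
    field_simp
    ring
  have hmin : IsMinOn (proxFun g x₁) K q := by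
    intro w hw
    have h : proxFun f x q ≤ proxFun f x w := hp hw
    have h' : (1 + m) * proxFun g x₁ q ≤ (1 + m) * proxFun g x₁ w := by rw [key, key]; linarith
    exact le_of_mul_le_mul_left h' h1m
  have hsub := hasSubgradientWithinAt_of_isMinOn_proxFun hgc hpK hmin z hz
  have h2 : (1 + m) * g q + (1 + m) * ⟪x₁ - q, z - q⟫ ≤ (1 + m) * g z := by nlinarith
  have eg : ∀ w : E, (1 + m) * g w = f w - m / 2 * ‖w‖ ^ 2 := fun w => by simp only [hg]; field_simp
  have ei : (1 + m) * ⟪x₁ - q, z - q⟫ = ⟪x - q, z - q⟫ - m * ⟪q, z - q⟫ := by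
    rw [hx₁, inner_sub_left, inner_sub_left, real_inner_smul_left, mul_sub, ← mul_assoc, mul_inv_cancel₀ h1m.ne', one_mul]
    ring
  rw [eg, eg, ei] at h2
  have e3 : ‖z - q‖ ^ 2 = ‖z‖ ^ 2 - 2 * ⟪q, z - q⟫ - ‖q‖ ^ 2 := by
    rw [norm_sub_sq_real, inner_sub_right, real_inner_self_eq_norm_sq, real_inner_comm]; ring
  rw [e3]
  linarith

/-- **UPPER LETTER (GROWTH, THE KERNEL's `½`)**: `e_K(x′) ≤ e_K(x) + ⟪x − p x, x′ − x⟫ + ½‖x′ − x‖²` — the competitor `p x ∈ K` in the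
problem at `x′` (membership of `p x` and minimality at `x′` only; no convexity). [folklore] -/
theorem windowEnv_upper (hpK : p x ∈ K) (hp' : IsMinOn (proxFun f x') K (p x')) :
    proxFun f x' (p x') ≤ proxFun f x (p x) + ⟪x - p x, x' - x⟫ + ‖x' - x‖ ^ 2 / 2 := by
  have h : proxFun f x' (p x') ≤ proxFun f x' (p x) := hp' hpK
  have e1 : ‖p x - x'‖ ^ 2 = ‖p x - x‖ ^ 2 - 2 * ⟪p x - x, x' - x⟫ + ‖x' - x‖ ^ 2 := by
    have : p x - x' = (p x - x) - (x' - x) := by abel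
    rw [this, norm_sub_sq_real]
  have e2 : ⟪x - p x, x' - x⟫ = -⟪p x - x, x' - x⟫ := by rw [← neg_sub (p x) x, inner_neg_left]
  simp only [proxFun_apply] at h ⊢
  rw [e1] at h; rw [e2]; linarith

/-- **LOWER LETTER (MODULUS `m∕(1+m)`)**: `StrongConvexOn K m f` (`0 ≤ m`), `p x ∈ K` minimising at `x`, `p x′ ∈ K` ⟹
`e_K(x) + ⟪x − p x, x′ − x⟫ + ((m∕(1+m))∕2)‖x′ − x‖² ≤ e_K(x′)` — the strong variational inequality at `p x` tested at `p x′`, plus the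
parallel-sum inequality `(m∕(1+m))‖d‖² ≤ ‖q − d‖² + m‖q‖²` (RESISTANCES ADD; `m = 0`: a supporting hyperplane). [folklore] -/
theorem windowEnv_lower (hf : StrongConvexOn K m f) (hm : 0 ≤ m) (hpK : p x ∈ K)
    (hp : IsMinOn (proxFun f x) K (p x)) (hpK' : p x' ∈ K) :
    proxFun f x (p x) + ⟪x - p x, x' - x⟫ + (m / (1 + m)) / 2 * ‖x' - x‖ ^ 2 ≤ proxFun f x' (p x') := by
  have h1m : 0 < 1 + m := by linarith
  have hsub := strongSubgradient_windowProx hf hm hpK hp hpK'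
  have hpar : ∀ q d : E, m / (1 + m) * ‖d‖ ^ 2 ≤ ‖q - d‖ ^ 2 + m * ‖q‖ ^ 2 := by
    intro q d
    have hsq : 0 ≤ ‖(q - d) + m • q‖ ^ 2 := sq_nonneg _
    have e1 : ‖(q - d) + m • q‖ ^ 2 = ‖q - d‖ ^ 2 + 2 * m * ⟪q - d, q⟫ + m ^ 2 * ‖q‖ ^ 2 := by
      rw [norm_add_sq_real, real_inner_smul_right, norm_smul, Real.norm_eq_abs, abs_of_nonneg hm, mul_pow]; ring
    have e2 : ‖d‖ ^ 2 = ‖q‖ ^ 2 - 2 * ⟪q - d, q⟫ + ‖q - d‖ ^ 2 := by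
      have : d = q - (q - d) := by abel
      rw [this, norm_sub_sq_real q (q - d), real_inner_comm]; abel_nf
    rw [div_mul_eq_mul_div, div_le_iff₀ h1m]
    nlinarith
  have hpq := hpar (p x' - p x) (x' - x)
  have epp : p x' - p x = (x' - x) - ((x' - p x') - (x - p x)) := by abel
  have e1 : ⟪x - p x, p x' - p x⟫ = ⟪x - p x, x' - x⟫ - ⟪x - p x, x' - p x'⟫ + ‖x - p x‖ ^ 2 := by
    rw [epp, inner_sub_right (x - p x) (x' - x) ((x' - p x') - (x - p x)),
      inner_sub_right (x - p x) (x' - p x') (x - p x), real_inner_self_eq_norm_sq]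
    ring
  have e2 : ‖(p x' - p x) - (x' - x)‖ ^ 2 = ‖x - p x‖ ^ 2 - 2 * ⟪x - p x, x' - p x'⟫ + ‖x' - p x'‖ ^ 2 := by
    have : (p x' - p x) - (x' - x) = (x - p x) - (x' - p x') := by abel
    rw [this, norm_sub_sq_real]
  simp only [proxFun_apply]
  rw [norm_sub_rev (p x) x, norm_sub_rev (p x') x']; rw [e2] at hpq; nlinarith [hsub, hpq, e1]

/-! ## §3 Moreau's theorem on a window: `e_K` is `C¹` and (strongly) convex ON ALL OF `E` -/

/-- **MOREAU's THEOREM ON A WINDOW** (Fréchet currency, any real inner product space).  `f` convex on the convex window `K`, `p` ANY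
selection of windowed proximal points (`p y ∈ K`, `IsMinOn (proxFun f y) K (p y)` for every `y`) ⟹ the windowed envelope
`y ↦ f (p y) + ½‖p y − y‖²` has Fréchet derivative `⟪x − p x, ·⟫` at EVERY `x : E`, from the sandwich
`0 ≤ e_K(x + h) − e_K(x) − ⟪x − p x, h⟫ ≤ ½‖h‖²` (§2 with `m = 0`).  No differentiability of `f`, no interiority: `f + ι_K` is `+∞` off
`K`, yet its envelope is `C¹` on all of `E`. [folklore] (Moreau 1965) -/
theorem hasFDerivAt_windowEnv (hf : ConvexOn ℝ K f) (hpK : ∀ y, p y ∈ K) (hp : ∀ y, IsMinOn (proxFun f y) K (p y)) (x : E) :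
    HasFDerivAt (fun y => proxFun f y (p y)) (innerSL ℝ (x - p x)) x := by
  rw [hasFDerivAt_iff_isLittleO_nhds_zero]
  refine Asymptotics.isLittleO_iff.2 fun c hc => ?_
  have hball : ∀ᶠ h : E in 𝓝 0, ‖h‖ < 2 * c :=
    Metric.eventually_nhds_iff.2 ⟨2 * c, by positivity, fun h hh => by simpa [dist_zero_right] using hh⟩
  filter_upwards [hball] with h hh
  have h0 := windowEnv_lower (x' := x + h) (strongConvexOn_zero.mpr hf) le_rfl (hpK x) (hp x) (hpK (x + h))
  have h2 := windowEnv_upper (x' := x + h) (hpK x) (hp (x + h))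
  simp only [add_sub_cancel_left, zero_div, zero_mul, add_zero] at h0 h2
  rw [innerSL_apply_apply, Real.norm_of_nonneg (by linarith)]
  nlinarith [norm_nonneg h]

/-- **MOREAU's THEOREM ON A WINDOW** (gradient currency, `E` complete): `HasGradientAt (y ↦ proxFun f y (p y)) (x − p x) x` at every
`x`, so `∇e_K x = x − p x`. [folklore] (Moreau 1965) -/
theorem hasGradientAt_windowEnv [CompleteSpace E] (hf : ConvexOn ℝ K f) (hpK : ∀ y, p y ∈ K)
    (hp : ∀ y, IsMinOn (proxFun f y) K (p y)) (x : E) :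
    HasGradientAt (fun y => proxFun f y (p y)) (x - p x) x := by
  rw [hasGradientAt_iff_hasFDerivAt]
  refine (hasFDerivAt_windowEnv hf hpK hp x).congr_fderiv ?_
  ext w; rw [innerSL_apply_apply, toDual_apply_apply]

/-- **SECANT CURRENCY, ON ALL OF `E`**: `StrongConvexOn K m f` (`0 ≤ m`) and any selection `p` ⟹ the windowed envelope is
`(m∕(1+m))`-strongly convex ON `univ` (Mathlib's `StrongConvexOn`) — §2's lower letter at the intermediate point, tested at both ends.
[folklore] -/
theorem strongConvexOn_windowEnv (hf : StrongConvexOn K m f) (hm : 0 ≤ m) (hpK : ∀ y, p y ∈ K)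
    (hp : ∀ y, IsMinOn (proxFun f y) K (p y)) :
    StrongConvexOn univ (m / (1 + m)) (fun y => proxFun f y (p y)) := by
  refine ⟨convex_univ, fun x _ y _ a b ha hb hab => ?_⟩
  set z := a • x + b • y with hz
  have hx := windowEnv_lower hf hm (hpK z) (hp z) (hpK x)
  have hy := windowEnv_lower hf hm (hpK z) (hp z) (hpK y)
  have hab' : b = 1 - a := by linarith
  have exz : x - z = b • (x - y) := by rw [hz, hab']; simp only [sub_smul, one_smul, smul_sub]; abel
  have eyz : y - z = -(a • (x - y)) := by rw [hz, hab']; simp only [sub_smul, one_smul, smul_sub]; abel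
  have hlin : a * ⟪z - p z, x - z⟫ + b * ⟪z - p z, y - z⟫ = 0 := by
    rw [exz, eyz, inner_neg_right, real_inner_smul_right, real_inner_smul_right]; ring
  have hnx : ‖x - z‖ ^ 2 = b ^ 2 * ‖x - y‖ ^ 2 := by rw [exz, norm_smul, Real.norm_eq_abs, abs_of_nonneg hb, mul_pow]
  have hny : ‖y - z‖ ^ 2 = a ^ 2 * ‖x - y‖ ^ 2 := by
    rw [eyz, norm_neg, norm_smul, Real.norm_eq_abs, abs_of_nonneg ha, mul_pow]
  rw [hnx] at hx; rw [hny] at hy; simp only [smul_eq_mul]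
  have := add_le_add (mul_le_mul_of_nonneg_left hx ha) (mul_le_mul_of_nonneg_left hy hb)
  rw [hab'] at this hlin ⊢
  nlinarith [this, hlin, sq_nonneg a, norm_nonneg (x - y), div_nonneg hm (by linarith : (0:ℝ) ≤ 1 + m)]

/-- **THE WINDOWED ENVELOPE IS CONVEX ON ALL OF `E`** for `f` convex on the window (`m = 0`). [folklore] -/
theorem convexOn_windowEnv (hf : ConvexOn ℝ K f) (hpK : ∀ y, p y ∈ K) (hp : ∀ y, IsMinOn (proxFun f y) K (p y)) :
    ConvexOn ℝ univ (fun y => proxFun f y (p y)) := by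
  have h := strongConvexOn_windowEnv (strongConvexOn_zero.mpr hf) le_rfl hpK hp
  rw [zero_div] at h; exact strongConvexOn_zero.mp h

/-! ## §4 The windowed proximal map contracts; the gradient is `1`-Lipschitz -/

/-- **THE WINDOWED PROXIMAL MAP IS A `(1+m)⁻¹`-CONTRACTION** (`StrongConvexOn K m f`, `0 ≤ m`; `m = 0`: firmly non-expansive, Moreau
1965): adding the two strong variational inequalities, each tested at the other point, gives `(1 + m)‖p x − p x′‖² ≤ ⟪x − x′, p x − p x′⟫`,
whence `‖p x − p x′‖ ≤ (1+m)⁻¹‖x − x′‖`. [folklore] -/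
theorem norm_windowProx_sub_le (hf : StrongConvexOn K m f) (hm : 0 ≤ m) (hpK : p x ∈ K)
    (hp : IsMinOn (proxFun f x) K (p x)) (hpK' : p x' ∈ K) (hp' : IsMinOn (proxFun f x') K (p x')) :
    (1 + m) * ‖p x - p x'‖ ^ 2 ≤ ⟪x - x', p x - p x'⟫ ∧ ‖p x - p x'‖ ≤ (1 + m)⁻¹ * ‖x - x'‖ := by
  have h1m : 0 < 1 + m := by linarith
  have h1 := strongSubgradient_windowProx hf hm hpK hp hpK'
  have h2 := strongSubgradient_windowProx hf hm hpK' hp' hpK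
  have e2 : ⟪x - p x, p x' - p x⟫ + ⟪x' - p x', p x - p x'⟫ = -⟪x - x', p x - p x'⟫ + ‖p x - p x'‖ ^ 2 := by
    have ea : p x' - p x = -(p x - p x') := by abel
    have eb : x' - p x' = (x - p x) - ((x - x') - (p x - p x')) := by abel
    rw [ea, inner_neg_right, eb, inner_sub_left (x - p x) ((x - x') - (p x - p x')),
      inner_sub_left (x - x') (p x - p x'), real_inner_self_eq_norm_sq]
    ring
  rw [norm_sub_rev (p x') (p x)] at h1
  have hfirm : (1 + m) * ‖p x - p x'‖ ^ 2 ≤ ⟪x - x', p x - p x'⟫ := by nlinarith [h1, h2, e2]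
  refine ⟨hfirm, ?_⟩
  rw [← div_eq_inv_mul, le_div_iff₀ h1m]
  nlinarith [norm_nonneg (x - x'), norm_nonneg (p x - p x'), real_inner_le_norm (x - x') (p x - p x')]

/-- The windowed proximal map of a convex-on-`K` `f` (any selection) is `LipschitzWith 1`, in particular continuous. [folklore] -/
theorem lipschitzWith_windowProx (hf : ConvexOn ℝ K f) (hpK : ∀ y, p y ∈ K) (hp : ∀ y, IsMinOn (proxFun f y) K (p y)) :
    LipschitzWith 1 p :=
  LipschitzWith.of_dist_le_mul fun x x' => by
    have h := (norm_windowProx_sub_le (strongConvexOn_zero.mpr hf) le_rfl (hpK x) (hp x) (hpK x') (hp x')).2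
    simp only [add_zero, inv_one, one_mul] at h
    simpa [dist_eq_norm] using h

/-- **THE GRADIENT IS `1`-LIPSCHITZ**: `‖(x − p x) − (x′ − p x′)‖ ≤ ‖x − x′‖` for `f` convex on `K` — from firm non-expansiveness
`‖q‖² ≤ ⟪d, q⟫` (`d = x − x′`, `q = p x − p x′`): `‖d − q‖² = ‖d‖² − 2⟪d, q⟫ + ‖q‖² ≤ ‖d‖²`.  The windowed envelope is `C^{1,1}` with
constant `1` whatever the convex `f` and the convex window `K`. [folklore] -/
theorem norm_windowGrad_sub_le (hf : ConvexOn ℝ K f) (hpK : p x ∈ K) (hp : IsMinOn (proxFun f x) K (p x))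
    (hpK' : p x' ∈ K) (hp' : IsMinOn (proxFun f x') K (p x')) : ‖(x - p x) - (x' - p x')‖ ≤ ‖x - x'‖ := by
  have h := (norm_windowProx_sub_le (strongConvexOn_zero.mpr hf) le_rfl hpK hp hpK' hp').1
  rw [add_zero, one_mul] at h
  have e : (x - p x) - (x' - p x') = (x - x') - (p x - p x') := by abel
  have hsq : ‖(x - p x) - (x' - p x')‖ ^ 2 ≤ ‖x - x'‖ ^ 2 := by
    rw [e, norm_sub_sq_real]
    nlinarith [sq_nonneg ‖p x - p x'‖]
  exact (pow_le_pow_iff_left₀ (norm_nonneg _) (norm_nonneg _) two_ne_zero).mp hsq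

/-! ## §5 Junctions: `K = univ` (the tree's `prox`, MEL's case) and `f = 0` (the metric projection) -/

/-- MEL's Moreau theorem as the `K = univ` instance of §3: the tree's `prox f` IS a selection of windowed proximal points for the
window `univ` (finite convex `f`, finite dimension) — kernel check of the junction. -/
example [FiniteDimensional ℝ E] (hf : ConvexOn ℝ univ f) (x : E) :
    HasGradientAt (fun y => proxFun f y (prox f y)) (x - prox f x) x :=
  haveI : CompleteSpace E := FiniteDimensional.complete ℝ E
  hasGradientAt_windowEnv hf (fun _ => mem_univ _) (fun y => isMinOn_prox hf y) x

/-- **JUNCTION `f = 0`: THE WINDOWED PROXIMAL POINT OF THE ZERO FUNCTION IS THE METRIC PROJECTION** — for convex `K` and `y ∈ K`, `y`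
minimises `z ↦ ½‖z − x‖²` on `K` iff the obtuse-angle criterion `∀ z ∈ K, ⟪x − y, z − y⟫ ≤ 0` holds (Mathlib's
`norm_eq_iInf_iff_real_inner_le_zero` in this file's currency). [folklore] -/
theorem isMinOn_proxFun_zero_iff (hK : Convex ℝ K) (hy : y ∈ K) :
    IsMinOn (proxFun (fun _ : E => (0 : ℝ)) x) K y ↔ ∀ z ∈ K, ⟪x - y, z - y⟫ ≤ 0 := by
  rw [isMinOn_proxFun_iff_hasSubgradientWithinAt (convexOn_const 0 hK) hy]
  simp [HasSubgradientWithinAt]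

/-- **`½·dist(·, K)²` IS `C¹` WITH DERIVATIVE `⟪x − proj_K x, ·⟫`** for ANY selection `p` of nearest points in a convex `K` (obtuse-angle
letters in): the `f = 0` instance of Moreau's theorem on a window. [folklore] -/
theorem hasFDerivAt_half_dist_sq (hK : Convex ℝ K) (hpK : ∀ y, p y ∈ K) (hobt : ∀ y, ∀ z ∈ K, ⟪y - p y, z - p y⟫ ≤ 0)
    (x : E) : HasFDerivAt (fun y => ‖p y - y‖ ^ 2 / 2) (innerSL ℝ (x - p x)) x := by
  have hp : ∀ y, IsMinOn (proxFun (fun _ : E => (0 : ℝ)) y) K (p y) := fun y =>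
    (isMinOn_proxFun_zero_iff hK (hpK y)).mpr (hobt y)
  simpa [proxFun_apply] using hasFDerivAt_windowEnv (convexOn_const 0 hK) hpK hp x

end Summit.QuantumFields.BalabanUV.T4Continuum.NE7b.WindowedMoreauEnvelope
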